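import Mathlib
import Summits.NavierStokesRegularity.NavierStokesRegularity.Theorems.L3TimeExponentPincerRingPersistenceImpulse
import Summits.NavierStokesRegularity.NavierStokesRegularity.Theorems.L3TimeExponentPincerVorticityL3Floor
import Literature.Analysis.FluidPDE.TaoEnstrophyLocalisationProofs
import Literature.Analysis.FluidPDE.LerayHopfProofs
import HarnessLib.Audit
import HarnessLib

/-!
# L3TimeExponentPincer — ring persistence: energy retention and the `L³` floor on the window

Support kernel for the crux `L3CascadeJaw` (item stmt-NavierStokesRegularity-19499): the last two
steps of the PERSISTENCE LEMMA `LpPersistence 3 (1/2) 2` (nsreg-p2 ROUND-11/12) for a given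
Tao-class solution `(u, p)` on `[0, T]` from an axisymmetric swirl-free datum `u₀` with
`η₀ = ω_θ/r ∈ L¹`, `|η₀| ≤ M`, `∫|η₀| ≤ m`, `∫ η₀⁻ ≤ m⁻`, `∫ r²η₀^± ≤ P`, on the window `[0, τ]` of
`absImpulse_le` (`∫ r²|Ω(t)| ≤ 4P`):

* `enstrophy_le` — `∫‖ω(t)‖² ≤ 4MP` (`‖ω‖² = r²Ω² ≤ M r²|Ω|`);
* `energy_ge` — energy retention `∫|u(t)|² ≥ E − 8νMP t` when `∫|u₀|² ≥ E` (energy EQUALITY of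
  classical solutions in Tao's class, `IsClassicalNSSolutionOn.energyEq`, and the `div`–`curl`
  bound `∫|∇u|² ≤ ∫|ω|²`, `lintegral_frobeniusNormSq_fderiv_le_lintegral_sq_norm_curl`);
* `l3_floor` — **the `L³` floor**: for `t ∈ [0, τ]` with `16 ν M P t ≤ E`,
  `‖u(t)‖_{L³} ≥ (π (E/2)³ / (512 W³))^{1/3}`, `W = √m · √(4P)` (kinematic floor
  `eLpNorm_three_ge_of_energy_of_vorticityMass` with `∫‖ω(t)‖ ≤ √(∫|η|)√(∫r²|η|) ≤ W`).

For a ring of speed `U`, size `ℓ` (`E ≍ U²ℓ³`, `M ≍ U/ℓ²`, `m ≍ Uℓ`, `P ≍ Uℓ³`) plus a dilute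
counter-shell: window `≍ ℓ²/ν`, floor `≍ Uℓ` — the memo's `σ = 1` idler. WHAT THIS IS NOT: not a
statement about blow-up; the explicit datum and the packaging into `LpPersistence 3 (1/2) 2` are the
sequel.
-/

namespace Summit.NavierStokesRegularity.NavierStokesRegularity.Theorems.L3TimeExponentPincerRingPersistenceFloor

open MeasureTheory Set Real Literature.Analysis.FluidPDE
open Summit.NavierStokesRegularity.NavierStokesRegularity.Theorems.L3TimeExponentPincerRingPersistenceDynamics
open Summit.NavierStokesRegularity.NavierStokesRegularity.Theorems.L3TimeExponentPincerRingPersistenceSlice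
open Summit.NavierStokesRegularity.NavierStokesRegularity.Theorems.L3TimeExponentPincerRingPersistenceImpulse
open Summit.NavierStokesRegularity.NavierStokesRegularity.Theorems.L3TimeExponentPincerVorticityL3Floor
open scoped ENNReal NNReal

/-- `ab ≤ a² + b²` in `ℝ≥0∞`. -/
private theorem ennreal_mul_le_sq_add_sq' (a b : ℝ≥0∞) : a * b ≤ a ^ 2 + b ^ 2 := by
  rcases le_total a b with hab | hab
  · calc a * b ≤ b * b := by gcongr
      _ = b ^ 2 := (sq b).symm
      _ ≤ a ^ 2 + b ^ 2 := le_add_self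
  · calc a * b ≤ a * a := by gcongr
      _ = a ^ 2 := (sq a).symm
      _ ≤ a ^ 2 + b ^ 2 := le_self_add

section Floor

variable {T ν : ℝ} {u₀ : EuclideanSpace ℝ (Fin 3) → EuclideanSpace ℝ (Fin 3)}
  {u : ℝ → EuclideanSpace ℝ (Fin 3) → EuclideanSpace ℝ (Fin 3)}
  {p : ℝ → EuclideanSpace ℝ (Fin 3) → ℝ}

/-- `∫⁻ r²|Ω| = ∫⁻ r²Ω⁺ + ∫⁻ r²Ω⁻`. -/
theorem lintegral_rsq_abs_eq (h : IsTaoSolutionOn T ν u₀ u p) {s : ℝ} (hs : s ∈ Icc 0 T) :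
    ∫⁻ x, ENNReal.ofReal (cylRadius x ^ 2 * |angVortQuot (u s) x|) =
      (∫⁻ x, ENNReal.ofReal (cylRadius x ^ 2 * (angVortQuot (u s) x)⁺)) +
        ∫⁻ x, ENNReal.ofReal (cylRadius x ^ 2 * (angVortQuot (u s) x)⁻) := by
  have hΩc : Continuous (angVortQuot (u s)) :=
    (contDiff_angVortQuot (n := 0) (by
      exact_mod_cast (h.classical.contDiff_velocity hs).of_le (by norm_cast))).continuous
  have hpc : Continuous fun x => (angVortQuot (u s) x)⁺ := by
    have e : (fun x => (angVortQuot (u s) x)⁺) = fun x => max (angVortQuot (u s) x) 0 :=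
      funext fun x => by rw [posPart_def]
    rw [e]; exact hΩc.max continuous_const
  have hm : Measurable fun x => ENNReal.ofReal (cylRadius x ^ 2 * (angVortQuot (u s) x)⁺) :=
    ((continuous_cylRadius.pow 2).mul hpc).measurable.ennreal_ofReal
  rw [← lintegral_add_left hm]
  refine lintegral_congr fun x => ?_
  rw [← ENNReal.ofReal_add (mul_nonneg (sq_nonneg _) (posPart_nonneg _))
    (mul_nonneg (sq_nonneg _) (negPart_nonneg _)), ← mul_add, posPart_add_negPart]

/-- **Enstrophy on the window**: `∫⁻ ‖ω(s)‖² ≤ M · ∫⁻ r²|Ω(s)|` (`‖ω‖ = r|Ω|`, `|Ω| ≤ M`). -/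
theorem lintegral_curl_sq_le (h : IsTaoSolutionOn T ν u₀ u p) (hT : 0 < T) (hν : 0 < ν)
    (h0 : IsAxisymmetric u₀) (h0' : HasNoSwirl u₀) {M : ℝ} (hM : ∀ x, |angVortQuot u₀ x| ≤ M)
    {s : ℝ} (hs : s ∈ Icc 0 T) :
    ∫⁻ x, ‖curl (u s) x‖ₑ ^ 2 ≤
      ENNReal.ofReal M * ∫⁻ x, ENNReal.ofReal (cylRadius x ^ 2 * |angVortQuot (u s) x|) := by
  have hax : IsAxisymmetric (u s) := h.isAxisymmetric hν hT h0 s hs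
  have hsw : HasNoSwirl (u s) := h.hasNoSwirl hν hT h0 h0' s hs
  have hu3 : ContDiff ℝ 3 (u s) := (h.classical.contDiff_velocity hs).of_le (by norm_cast)
  have hωeq : ∀ x, ‖curl (u s) x‖ = cylRadius x * |angVortQuot (u s) x| :=
    norm_curl_eq_cylRadius_mul_abs_angVortQuot hax hsw hu3
  have hM0 : 0 ≤ M := (abs_nonneg _).trans (hM 0)
  have hΩM : ∀ x, |angVortQuot (u s) x| ≤ M := fun x =>
    h.abs_angVortQuot_le_of_datum hT hν h0 h0' hM hs x
  rw [← lintegral_const_mul' _ _ ENNReal.ofReal_ne_top]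
  refine lintegral_mono fun x => ?_
  rw [← ofReal_norm, ← ENNReal.ofReal_pow (norm_nonneg _), ← ENNReal.ofReal_mul hM0, hωeq x]
  refine ENNReal.ofReal_le_ofReal ?_
  have hr := sq_nonneg (cylRadius x)
  have ha := abs_nonneg (angVortQuot (u s) x)
  calc (cylRadius x * |angVortQuot (u s) x|) ^ 2
      = (cylRadius x ^ 2 * |angVortQuot (u s) x|) * |angVortQuot (u s) x| := by ring
    _ ≤ (cylRadius x ^ 2 * |angVortQuot (u s) x|) * M :=
        mul_le_mul_of_nonneg_left (hΩM x) (mul_nonneg hr ha)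
    _ = M * (cylRadius x ^ 2 * |angVortQuot (u s) x|) := mul_comm _ _

/-- **Energy equality in Tao's class** (Leray's energy identity for classical solutions with the
integrability supplied by `HasBoundedSobolevNormsOn`): for `t ∈ [0, T]`,
`KE(u(t)) + ν ∫₀ᵗ∫|∇u|² = KE(u₀)`. -/
theorem kineticEnergy_add_dissipation_eq (h : IsTaoSolutionOn T ν u₀ u p) (hT : 0 < T) {t : ℝ}
    (ht : t ∈ Icc 0 T) :
    VectorCalculus.kineticEnergy (u t) +
      ν * (∫⁻ τ in Ioo 0 t, ∫⁻ x, ENNReal.ofReal (frobeniusNormSq (fderiv ℝ (u τ) x))).toReal =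
      VectorCalculus.kineticEnergy u₀ := by
  obtain ⟨B, hB0, hB⟩ := h.exists_bound_velocity
  obtain ⟨C₀, hC₀⟩ := h.sobolev 0
  obtain ⟨C₁, hC₁⟩ := h.sobolev 1
  obtain ⟨P₀, hP₀⟩ := h.sobolev_p 0
  have hvol : volume (Ioo (0 : ℝ) T) < ⊤ := by simp
  have hu0 : ∀ s ∈ Icc 0 T, ∫⁻ x, ‖u s x‖ₑ ^ 2 ≤ C₀ := fun s hs =>
    (le_of_eq (lintegral_congr fun x => by rw [← ofReal_norm, ← norm_iteratedFDeriv_zero (𝕜 := ℝ)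
      (f := u s), ofReal_norm])).trans (hC₀ s hs)
  have hp0 : ∀ s ∈ Icc 0 T, ∫⁻ x, ‖p s x‖ₑ ^ 2 ≤ P₀ := fun s hs =>
    (le_of_eq (lintegral_congr fun x => by rw [← ofReal_norm, ← norm_iteratedFDeriv_zero (𝕜 := ℝ)
      (f := p s), ofReal_norm])).trans (hP₀ s hs)
  have hmem : ∀ s ∈ Icc 0 T, MemLp (u s) 2 volume := fun s hs => h.continuousL2.1 s hs
  have hE : ∀ s ∈ Icc 0 T, eEnergy (u s) ≤ (C₀ : ℝ≥0∞) := fun s hs => hu0 s hs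
  have hgrad : ∫⁻ s in Ioo 0 T, ∫⁻ x, ENNReal.ofReal (frobeniusNormSq (fderiv ℝ (u s) x)) < ⊤ := by
    have hle : ∀ s ∈ Icc 0 T,
        ∫⁻ x, ENNReal.ofReal (frobeniusNormSq (fderiv ℝ (u s) x)) ≤ 3 * C₁ := by
      intro s hs
      calc ∫⁻ x, ENNReal.ofReal (frobeniusNormSq (fderiv ℝ (u s) x))
          ≤ ∫⁻ x, 3 * ‖iteratedFDeriv ℝ 1 (u s) x‖ₑ ^ 2 := lintegral_mono fun x => by
            rw [← ofReal_norm, norm_iteratedFDeriv_one, ofReal_norm]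
            exact ofReal_frobeniusNormSq_le_three_mul_enorm_sq _
        _ = 3 * ∫⁻ x, ‖iteratedFDeriv ℝ 1 (u s) x‖ₑ ^ 2 := lintegral_const_mul' _ _ (by simp)
        _ ≤ 3 * C₁ := by gcongr; exact hC₁ s hs
    calc ∫⁻ s in Ioo 0 T, ∫⁻ x, ENNReal.ofReal (frobeniusNormSq (fderiv ℝ (u s) x))
        ≤ ∫⁻ _ in Ioo 0 T, 3 * (C₁ : ℝ≥0∞) :=
          setLIntegral_mono' measurableSet_Ioo fun s hs => hle s (Ioo_subset_Icc_self hs)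
      _ < ⊤ := by
          rw [setLIntegral_const]
          exact ENNReal.mul_lt_top (ENNReal.mul_lt_top (by simp) ENNReal.coe_lt_top) hvol
  have hu3 : ∫⁻ s in Ioo 0 T, ∫⁻ x, ‖u s x‖ₑ ^ (3 : ℕ) < ⊤ := by
    have hle : ∀ s ∈ Icc 0 T, ∫⁻ x, ‖u s x‖ₑ ^ (3 : ℕ) ≤ ENNReal.ofReal B * C₀ := by
      intro s hs
      calc ∫⁻ x, ‖u s x‖ₑ ^ (3 : ℕ) ≤ ∫⁻ x, ENNReal.ofReal B * ‖u s x‖ₑ ^ 2 :=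
            lintegral_mono fun x => by
              rw [pow_succ, mul_comm]
              gcongr
              rw [← ofReal_norm]
              exact ENNReal.ofReal_le_ofReal (hB s hs x)
        _ = ENNReal.ofReal B * ∫⁻ x, ‖u s x‖ₑ ^ 2 := lintegral_const_mul' _ _ ENNReal.ofReal_ne_top
        _ ≤ ENNReal.ofReal B * C₀ := by gcongr; exact hu0 s hs
    calc ∫⁻ s in Ioo 0 T, ∫⁻ x, ‖u s x‖ₑ ^ (3 : ℕ)
        ≤ ∫⁻ _ in Ioo 0 T, ENNReal.ofReal B * (C₀ : ℝ≥0∞) :=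
          setLIntegral_mono' measurableSet_Ioo fun s hs => hle s (Ioo_subset_Icc_self hs)
      _ < ⊤ := by
          rw [setLIntegral_const]
          exact ENNReal.mul_lt_top (ENNReal.mul_lt_top ENNReal.ofReal_lt_top ENNReal.coe_lt_top) hvol
  have hpu : ∫⁻ s in Ioo 0 T, ∫⁻ x, ‖p s x‖ₑ * ‖u s x‖ₑ < ⊤ := by
    have hle : ∀ s ∈ Icc 0 T, ∫⁻ x, ‖p s x‖ₑ * ‖u s x‖ₑ ≤ P₀ + C₀ := by
      intro s hs
      calc ∫⁻ x, ‖p s x‖ₑ * ‖u s x‖ₑ ≤ ∫⁻ x, (‖p s x‖ₑ ^ 2 + ‖u s x‖ₑ ^ 2) :=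
            lintegral_mono fun x => ennreal_mul_le_sq_add_sq' _ _
        _ = (∫⁻ x, ‖p s x‖ₑ ^ 2) + ∫⁻ x, ‖u s x‖ₑ ^ 2 :=
            lintegral_add_left' ((h.classical.contDiff_pressure hs).continuous.aemeasurable.enorm.pow_const
              _) _
        _ ≤ P₀ + C₀ := add_le_add (hp0 s hs) (hu0 s hs)
    calc ∫⁻ s in Ioo 0 T, ∫⁻ x, ‖p s x‖ₑ * ‖u s x‖ₑ
        ≤ ∫⁻ _ in Ioo 0 T, ((P₀ : ℝ≥0∞) + C₀) :=
          setLIntegral_mono' measurableSet_Ioo fun s hs => hle s (Ioo_subset_Icc_self hs)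
      _ < ⊤ := by
          rw [setLIntegral_const]
          exact ENNReal.mul_lt_top (by simp [ENNReal.add_lt_top]) hvol
  have hf : ∫⁻ s in Ioo 0 T, ∫⁻ x, ‖(0 : ℝ → EuclideanSpace ℝ (Fin 3) → EuclideanSpace ℝ (Fin 3)) s x‖ₑ *
      ‖u s x‖ₑ < ⊤ := by simp
  have key := h.classical.energyEq hT hmem (M := (C₀ : ℝ≥0∞)) ENNReal.coe_ne_top hE hgrad hu3 hpu hf
    le_rfl ht.1 ht.2
  simp only [Pi.zero_apply, inner_zero_left, integral_zero, intervalIntegral.integral_zero,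
    add_zero] at key
  rw [h.initial] at key
  exact key

/-- **Energy retention on the window.** Under the hypotheses of `absImpulse_le` and
`ofReal E ≤ ∫⁻ |u₀|²`, for every `t ∈ [0, τ]`: `ofReal (E − 8 ν M P t) ≤ ∫⁻ |u(t)|²`. -/
theorem energy_ge (h : IsTaoSolutionOn T ν u₀ u p) (hT : 0 < T) (hν : 0 < ν)
    (h0 : IsAxisymmetric u₀) (h0' : HasNoSwirl u₀) (hL1 : Integrable (angVortQuot u₀))
    {M m mneg P : ℝ} (hM : ∀ x, |angVortQuot u₀ x| ≤ M) (hm : ∫ x, |angVortQuot u₀ x| ≤ m)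
    (hmneg : ∫⁻ x, ENNReal.ofReal ((angVortQuot u₀ x)⁻) ≤ ENNReal.ofReal mneg) (hmneg0 : 0 ≤ mneg)
    (hP : 0 < P)
    (hPp : ∫⁻ x, ENNReal.ofReal (cylRadius x ^ 2 * (angVortQuot u₀ x)⁺) ≤ ENNReal.ofReal P)
    (hPn : ∫⁻ x, ENNReal.ofReal (cylRadius x ^ 2 * (angVortQuot u₀ x)⁻) ≤ ENNReal.ofReal P)
    {τ : ℝ} (hτ : τ ∈ Ioc 0 T)
    (hsmall : 2 * τ * (6 * Real.sqrt (M * Real.sqrt m) * Real.sqrt mneg) ≤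
      Real.sqrt (Real.sqrt (2 * P)) / 2)
    {E : ℝ} (hEu : ENNReal.ofReal E ≤ ∫⁻ x, ‖u₀ x‖ₑ ^ 2) {t : ℝ} (ht : t ∈ Icc 0 τ) :
    ENNReal.ofReal (E - 8 * ν * M * P * t) ≤ ∫⁻ x, ‖u t x‖ₑ ^ 2 := by
  have htT : t ∈ Icc 0 T := ⟨ht.1, ht.2.trans hτ.2⟩
  have hM0 : 0 ≤ M := (abs_nonneg _).trans (hM 0)
  -- dissipation on `(0, t)` is at most `4 M P t`
  have hD : ∫⁻ s in Ioo 0 t, ∫⁻ x, ENNReal.ofReal (frobeniusNormSq (fderiv ℝ (u s) x)) ≤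
      ENNReal.ofReal (4 * M * P * t) := by
    have hle : ∀ s ∈ Ioo 0 t, ∫⁻ x, ENNReal.ofReal (frobeniusNormSq (fderiv ℝ (u s) x)) ≤
        ENNReal.ofReal (M * (4 * P)) := by
      intro s hs
      have hsτ : s ∈ Icc 0 τ := ⟨hs.1.le, hs.2.le.trans ht.2⟩
      have hsT : s ∈ Icc 0 T := ⟨hs.1.le, hsτ.2.trans hτ.2⟩
      obtain ⟨hsm, hdv, hH⟩ := h.slice hsT
      have hL2 : ∫⁻ x, ‖u s x‖ₑ ^ 2 < ⊤ := by
        have := hH 0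
        exact lt_of_le_of_lt (le_of_eq (lintegral_congr fun x => by
          rw [← ofReal_norm, ← norm_iteratedFDeriv_zero (𝕜 := ℝ) (f := u s), ofReal_norm])) this
      calc ∫⁻ x, ENNReal.ofReal (frobeniusNormSq (fderiv ℝ (u s) x))
          ≤ ∫⁻ x, ‖curl (u s) x‖ₑ ^ 2 :=
            lintegral_frobeniusNormSq_fderiv_le_lintegral_sq_norm_curl (hsm.of_le (by norm_cast)) hdv hL2
        _ ≤ ENNReal.ofReal M * ∫⁻ x, ENNReal.ofReal (cylRadius x ^ 2 * |angVortQuot (u s) x|) :=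
            lintegral_curl_sq_le h hT hν h0 h0' hM hsT
        _ = ENNReal.ofReal M * ((∫⁻ x, ENNReal.ofReal (cylRadius x ^ 2 * (angVortQuot (u s) x)⁺)) +
              ∫⁻ x, ENNReal.ofReal (cylRadius x ^ 2 * (angVortQuot (u s) x)⁻)) := by
            rw [lintegral_rsq_abs_eq h hsT]
        _ ≤ ENNReal.ofReal M * ENNReal.ofReal (4 * P) := by
            gcongr
            exact absImpulse_le h hT hν h0 h0' hL1 hM hm hmneg hmneg0 hP hPp hPn hτ hsmall hsτ
        _ = ENNReal.ofReal (M * (4 * P)) := (ENNReal.ofReal_mul hM0).symm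
    calc ∫⁻ s in Ioo 0 t, ∫⁻ x, ENNReal.ofReal (frobeniusNormSq (fderiv ℝ (u s) x))
        ≤ ∫⁻ _ in Ioo 0 t, ENNReal.ofReal (M * (4 * P)) := setLIntegral_mono' measurableSet_Ioo hle
      _ = ENNReal.ofReal (4 * M * P * t) := by
          rw [setLIntegral_const, Real.volume_Ioo, sub_zero, ← ENNReal.ofReal_mul (by positivity)]
          congr 1; ring
  -- energy equality
  have hEq := kineticEnergy_add_dissipation_eq h hT htT
  have hKE0 : E ≤ 2 * VectorCalculus.kineticEnergy u₀ := by
    have hLH := h.isLerayHopfOn hT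
    have e0 := hLH.eEnergy_eq (t := 0) ⟨le_rfl, hT.le⟩
    rw [h.initial] at e0
    have hKn : 0 ≤ 2 * VectorCalculus.kineticEnergy u₀ := by
      have := Literature.Analysis.FluidPDE.kineticEnergy_nonneg u₀; linarith
    have : ENNReal.ofReal E ≤ ENNReal.ofReal (2 * VectorCalculus.kineticEnergy u₀) := by
      rw [← e0]; exact hEu
    exact (ENNReal.ofReal_le_ofReal_iff hKn).1 this
  have hDreal : (∫⁻ s in Ioo 0 t, ∫⁻ x, ENNReal.ofReal (frobeniusNormSq (fderiv ℝ (u s) x))).toReal ≤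
      4 * M * P * t := by
    have := ENNReal.toReal_mono ENNReal.ofReal_ne_top hD
    rwa [ENNReal.toReal_ofReal (by have := ht.1; positivity)] at this
  have hKEt : E - 8 * ν * M * P * t ≤ 2 * VectorCalculus.kineticEnergy (u t) := by
    have hνD : ν * (∫⁻ s in Ioo 0 t, ∫⁻ x, ENNReal.ofReal (frobeniusNormSq (fderiv ℝ (u s) x))).toReal ≤
        ν * (4 * M * P * t) := mul_le_mul_of_nonneg_left hDreal hν.le
    linarith
  have et := (h.isLerayHopfOn hT).eEnergy_eq htT
  change ∫⁻ x, ‖u t x‖ₑ ^ 2 = ENNReal.ofReal (2 * VectorCalculus.kineticEnergy (u t)) at et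
  rw [et]
  exact ENNReal.ofReal_le_ofReal hKEt

/-- **THE `L³` FLOOR ON THE PERSISTENCE WINDOW.** Under the hypotheses of `absImpulse_le`, with
`0 < m`, `ofReal E ≤ ∫⁻|u₀|²`, `0 < E`, and for `t ∈ [0, τ]` with `16 ν M P t ≤ E`:
`‖u(t)‖_{L³} ≥ (π (E/2)³ / (512 (√m √(4P))³))^{1/3}`. -/
theorem l3_floor (h : IsTaoSolutionOn T ν u₀ u p) (hT : 0 < T) (hν : 0 < ν)
    (h0 : IsAxisymmetric u₀) (h0' : HasNoSwirl u₀) (hL1 : Integrable (angVortQuot u₀))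
    {M m mneg P : ℝ} (hM : ∀ x, |angVortQuot u₀ x| ≤ M) (hm0 : 0 < m)
    (hm : ∫ x, |angVortQuot u₀ x| ≤ m)
    (hmneg : ∫⁻ x, ENNReal.ofReal ((angVortQuot u₀ x)⁻) ≤ ENNReal.ofReal mneg) (hmneg0 : 0 ≤ mneg)
    (hP : 0 < P)
    (hPp : ∫⁻ x, ENNReal.ofReal (cylRadius x ^ 2 * (angVortQuot u₀ x)⁺) ≤ ENNReal.ofReal P)
    (hPn : ∫⁻ x, ENNReal.ofReal (cylRadius x ^ 2 * (angVortQuot u₀ x)⁻) ≤ ENNReal.ofReal P)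
    {τ : ℝ} (hτ : τ ∈ Ioc 0 T)
    (hsmall : 2 * τ * (6 * Real.sqrt (M * Real.sqrt m) * Real.sqrt mneg) ≤
      Real.sqrt (Real.sqrt (2 * P)) / 2)
    {E : ℝ} (hE : 0 < E) (hEu : ENNReal.ofReal E ≤ ∫⁻ x, ‖u₀ x‖ₑ ^ 2)
    {t : ℝ} (ht : t ∈ Icc 0 τ) (htE : 16 * ν * M * P * t ≤ E) :
    ENNReal.ofReal ((π * (E / 2) ^ 3 / (512 * (Real.sqrt m * Real.sqrt (4 * P)) ^ 3)) ^ (1 / 3 : ℝ)) ≤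
      eLpNorm (u t) 3 volume := by
  have htT : t ∈ Icc 0 T := ⟨ht.1, ht.2.trans hτ.2⟩
  have hax : ∀ s ∈ Icc 0 T, IsAxisymmetric (u s) := h.isAxisymmetric hν hT h0
  have hsw : ∀ s ∈ Icc 0 T, HasNoSwirl (u s) := h.hasNoSwirl hν hT h0 h0'
  have h0T : (0 : ℝ) ∈ Icc 0 T := ⟨le_rfl, hT.le⟩
  -- finiteness of the moments at time `t`
  have hQ := absImpulse_le h hT hν h0 h0' hL1 hM hm hmneg hmneg0 hP hPp hPn hτ hsmall ht
  have hfp : ∫⁻ x, ENNReal.ofReal (cylRadius x ^ 2 * (angVortQuot (u t) x)⁺) < ⊤ :=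
    lt_of_le_of_lt le_self_add (hQ.trans_lt ENNReal.ofReal_lt_top)
  have hfn : ∫⁻ x, ENNReal.ofReal (cylRadius x ^ 2 * (angVortQuot (u t) x)⁻) < ⊤ :=
    lt_of_le_of_lt le_add_self (hQ.trans_lt ENNReal.ofReal_lt_top)
  obtain ⟨hΩi, -, -, hrp, hrn, hrΩ, hrabs, -⟩ := integrable_rsq_parts h hT hν h0 h0' hL1 htT hfp hfn
  obtain ⟨hωint, hW⟩ := vorticityMass_le_sqrt h hT hν h0 h0' htT hΩi hrΩ
  -- `∫|Ω t| ≤ m`, `∫ r²|Ω t| ≤ 4P`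
  have hA : ∫ x, |angVortQuot (u t) x| ≤ m := by
    have hle := (h.integrable_angVortQuot_of_datum hT hν h0 h0' hL1 htT).2
    have e1 : ∫ x, |angVortQuot (u t) x| = (∫⁻ x, ‖angVortQuot (u t) x‖ₑ).toReal := by
      rw [← integral_norm_eq_lintegral_enorm hΩi.1]; simp only [Real.norm_eq_abs]
    have e2 : ∫ x, |angVortQuot u₀ x| = (∫⁻ x, ‖angVortQuot u₀ x‖ₑ).toReal := by
      rw [← integral_norm_eq_lintegral_enorm hL1.1]; simp only [Real.norm_eq_abs]
    rw [e1]
    refine le_trans (ENNReal.toReal_mono hL1.2.ne hle) ?_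
    rw [← e2]; exact hm
  have hYq : ∫ x, cylRadius x ^ 2 * |angVortQuot (u t) x| ≤ 4 * P := by
    have e : ENNReal.ofReal (∫ x, cylRadius x ^ 2 * |angVortQuot (u t) x|) =
        ∫⁻ x, ENNReal.ofReal (cylRadius x ^ 2 * |angVortQuot (u t) x|) :=
      ofReal_integral_eq_lintegral_ofReal hrabs (ae_of_all _ fun x =>
        mul_nonneg (sq_nonneg _) (abs_nonneg _))
    have h1 : ENNReal.ofReal (∫ x, cylRadius x ^ 2 * |angVortQuot (u t) x|) ≤ ENNReal.ofReal (4 * P) := by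
      rw [e, lintegral_rsq_abs_eq h htT]; exact hQ
    exact (ENNReal.ofReal_le_ofReal_iff (by positivity)).1 h1
  -- the vorticity mass `≤ W`
  set W : ℝ := Real.sqrt m * Real.sqrt (4 * P) with hWdef
  have hW0 : 0 < W := by positivity
  have hWω : ∫ y, ‖curl (u t) y‖ ≤ W :=
    hW.trans (mul_le_mul (Real.sqrt_le_sqrt hA) (Real.sqrt_le_sqrt hYq) (Real.sqrt_nonneg _)
      (Real.sqrt_nonneg _))
  -- the energy floor `E/2`
  have hX : 0 < E / 2 := by positivity
  have hfloor : ENNReal.ofReal (E / 2) ≤ ∫⁻ x, ‖u t x‖ₑ ^ 2 := by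
    refine le_trans (ENNReal.ofReal_le_ofReal ?_)
      (energy_ge h hT hν h0 h0' hL1 hM hm hmneg hmneg0 hP hPp hPn hτ hsmall hEu ht)
    linarith
  exact eLpNorm_three_ge_of_energy_of_vorticityMass h htT hωint hW0 hWω hX hfloor

end Floor

/--
info: 'Summit.NavierStokesRegularity.NavierStokesRegularity.Theorems.L3TimeExponentPincerRingPersistenceFloor.l3_floor' depends on axioms: [propext,
 Classical.choice,
 Quot.sound]
-/
#guard_msgs in
#print axioms l3_floor

end Summit.NavierStokesRegularity.NavierStokesRegularity.Theorems.L3TimeExponentPincerRingPersistenceFloor
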